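import Summits.ABC.ABC.Theorems.IneffectiveSubspaceUniformSadicTowerFourThreeSlotOnePrime

/-!
# `UniformSadicTowerFour` (stmt-ABC-14937), line `flat-steep-split` (lead c5): axis separation at
# the first open rung `W = 3` — only the TWO-LOG part of the one-prime / two-base bound is used

Modulo the route's crux #6 the crux is BoundedOmegaABC, whose first open rung `W = 3` (`B₃`: abc
with `C = C(ε)` on the cell `ω(abc) ≤ 3`) was derived in `…ThreeSlotOnePrime.lean` from the
one-prime / two-base divisibility bound UPD(1,2): for every `ε > 0` there is `C` such that for
pairwise distinct primes `p, q, r` and `Y, Z, t ∈ ℕ`, `p^t ∣ q^Y r^Z − 1` (with `q^Y r^Z ≥ 2`)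
or `p^t ∣ r^Z − q^Y` (with `q^Y < r^Z`) implies `p^t ≤ C · (pqr)^(1+ε) · (q^Y r^Z)^ε`.
UPD(1,2) has two axes: its **two-log part** UPD⁺(1,2), the same statement for `Y, Z ≥ 1`, and its
**one-log / one-base axis** UPD(1,1): `p^t ∣ r^Z − 1`, `r^Z ≥ 2` `⟹ p^t ≤ C (pr)^(1+ε) (r^Z)^ε`.
This file separates them (all three statements are OPEN, abc-type, and appear only inlined as
hypotheses resp. as the sides of an equivalence; no definitions):

* `onePrimeTwoBase_iff_pos_and_oneBase`: UPD(1,2) ⟺ UPD⁺(1,2) ∧ UPD(1,1).  (→) UPD⁺ by dropping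
  the two extra binders; UPD(1,1) from `Y = 0` and an auxiliary prime `q ∈ {2, 3, 5}` distinct
  from `p, r` (`twoLog_exists_aux_prime`), at the cost of the factor `5^(1+ε)`.  (←) with the
  constant `C⁺ + C₁`: for `Y = 0` both alternatives read `p^t ∣ r^Z − 1`, `r^Z ≥ 2` (UPD(1,1) for
  `(p, r)`, then `(pr)^(1+ε) ≤ (pqr)^(1+ε)`); for `Z = 0` the first alternative is
  `p^t ∣ q^Y − 1`, `q^Y ≥ 2` (UPD(1,1) for `(p, q)`) and the second, `q^Y < 1`, is void; for
  `Y, Z ≥ 1` it is UPD⁺.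
* `boundedOmegaAt_three_of_onePrimeTwoBasePos`: `B₃` follows from UPD⁺(1,2) ALONE — the proof of
  `boundedOmegaAt_three_of_onePrimeTwoBase` (charge one prime; the squaring trick) only ever
  applies the bound with both exponents `≥ 1`: shape (C) `p^x + q^y = r^z` with `Y = 2y`,
  `Z = 2x`, shape (A) `1 + p^x q^y = r^z` with `Y = 2x`, `Z = 2y`, shape (B) `1 + p^x = q^y r^z`
  with `Y = y`, `Z = z`, always in the main case `x, y, z ≥ 1`; the degenerate case (an exponent
  vanishes or two primes coincide) is the cell `ω ≤ 2` (`MixedRadical.stub_omegaCounted_two`).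
  The three shapes, with one constant, are `shapes_of_onePrimeTwoBasePos` (proof verbatim the
  one of `…ThreeSlotOnePrime.lean`, whose private helpers are re-proved under the prefix
  `twoLog_`: with `0 < δ ≤ min(ε,1)/10` and `M = pqr`, `c ≤ 2 C_U M^(1+δ) X^δ` with `X ≤ c⁴` is
  absorbed into `c < (C₂ + (2C_U)^{1/(1−4δ)} + 1) M^(1+ε)` by `twoLog_final_lt`), and `B₃`
  follows by `boundedOmegaAt_three_iff_shapes`.

Sources: the crux notes of the line (`Cruxes/UniformSadicTowerFour/`, lead c5); everything is
elementary [folklore].  Mathlib only (`Nat.sq_sub_sq`, `Nat.radical_dvd_iff`, `Finset.card_le_two`,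
`Nat.prime_eq_prime_of_dvd_pow`, `Real.rpow_sub`, `Real.rpow_mul`, `Real.mul_rpow`,
`Real.rpow_le_rpow(_of_exponent_le)`) and the landed `boundedOmegaAt_three_iff_shapes`,
`MixedRadical.stub_omegaCounted_two`.  Deliberately NOT here: the sources and consequences of the
one-log axis UPD(1,1), the depth-counted slot and the 2-pinned form of `B₃` (other files).
-/

noncomputable section

-- `Summit.<Summit>.<Problem>` is the mandated summit-side namespace (CONVENTIONS §2); for the
-- single-conjunct summit `ABC` the two coincide, so the duplicate `ABC.ABC` is deliberate.
set_option linter.dupNamespace false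

namespace Summit.ABC.ABC.Theorems.UniformSadicTowerFour.BoundedOmega

open Literature.NumberTheory.DiophantineGeometry (IsABCTriple rad rad_def)
open Summit.ABC.ABC.Theorems.UniformSadicTowerFour.MixedRadical (stub_omegaCounted_two)
open UniqueFactorizationMonoid (radical)

/-! ## Three prime powers; monotonicity; the squaring trick; real-analysis bookkeeping -/

/-- For primes `p, q, r`, a prime factor `s` of `p^x q^y r^z` is `p` (and then `x ≠ 0`), `q`
(and then `y ≠ 0`) or `r` (and then `z ≠ 0`). [folklore] -/
private theorem twoLog_mem_primeFactors_threePow {p q r x y z s : ℕ} (hp : p.Prime)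
    (hq : q.Prime) (hr : r.Prime) (hs : s ∈ (p ^ x * q ^ y * r ^ z).primeFactors) :
    (s = p ∧ x ≠ 0) ∨ (s = q ∧ y ≠ 0) ∨ (s = r ∧ z ≠ 0) := by
  obtain ⟨hs', hdvd, -⟩ := Nat.mem_primeFactors.1 hs
  have key : ∀ {b e : ℕ}, b.Prime → s ∣ b ^ e → s = b ∧ e ≠ 0 := by
    intro b e hb h
    refine ⟨(Nat.prime_dvd_prime_iff_eq hs' hb).1 (hs'.dvd_of_dvd_pow h), ?_⟩
    rintro rfl
    rw [pow_zero, Nat.dvd_one] at h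
    exact hs'.one_lt.ne' h
  rcases (Nat.Prime.dvd_mul hs').1 hdvd with h | h
  · rcases (Nat.Prime.dvd_mul hs').1 h with h | h
    · exact Or.inl (key hp h)
    · exact Or.inr (Or.inl (key hq h))
  · exact Or.inr (Or.inr (key hr h))

/-- For primes `p, q, r`: `rad(p^x q^y r^z) ≤ pqr`, as the radical divides `pqr`
(`Nat.radical_dvd_iff`, `twoLog_mem_primeFactors_threePow`). [folklore] -/
private theorem twoLog_radical_threePow_le {p q r : ℕ} (hp : p.Prime) (hq : q.Prime)
    (hr : r.Prime) (x y z : ℕ) : radical (p ^ x * q ^ y * r ^ z) ≤ p * q * r := by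
  have h0 : p * q * r ≠ 0 := mul_ne_zero (mul_ne_zero hp.ne_zero hq.ne_zero) hr.ne_zero
  refine Nat.le_of_dvd (Nat.pos_of_ne_zero h0) ((Nat.radical_dvd_iff h0).2 fun s hs => ?_)
  refine Nat.mem_primeFactors.2 ⟨Nat.prime_of_mem_primeFactors hs, ?_, h0⟩
  rcases twoLog_mem_primeFactors_threePow hp hq hr hs with ⟨rfl, -⟩ | ⟨rfl, -⟩ | ⟨rfl, -⟩
  · exact dvd_mul_of_dvd_left (dvd_mul_right _ _) _
  · exact dvd_mul_of_dvd_left (dvd_mul_left _ _) _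
  · exact dvd_mul_left _ _

/-- **The degenerate cell.** If two of the primes `p, q, r` coincide or one of `x, y, z`
vanishes, then `p^x q^y r^z` has at most two prime factors. [folklore] -/
private theorem twoLog_card_primeFactors_threePow_le_two {p q r x y z : ℕ} (hp : p.Prime)
    (hq : q.Prime) (hr : r.Prime) (h : p = q ∨ p = r ∨ q = r ∨ x = 0 ∨ y = 0 ∨ z = 0) :
    (p ^ x * q ^ y * r ^ z).primeFactors.card ≤ 2 := by
  obtain ⟨a, b, hab⟩ : ∃ a b : ℕ, ∀ s : ℕ,
      (s = p ∧ x ≠ 0) ∨ (s = q ∧ y ≠ 0) ∨ (s = r ∧ z ≠ 0) → s = a ∨ s = b := by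
    rcases h with h | h | h | h | h | h <;> first
      | exact ⟨p, r, fun s hs => by omega⟩ | exact ⟨p, q, fun s hs => by omega⟩
      | exact ⟨q, r, fun s hs => by omega⟩
  refine (Finset.card_le_card fun s hs => ?_).trans (Finset.card_le_two (a := a) (b := b))
  rw [Finset.mem_insert, Finset.mem_singleton]
  exact hab s (twoLog_mem_primeFactors_threePow hp hq hr hs)

/-- Monotonicity of the divisibility bound `C · M^(1+ε) · X` (`X ≥ 0`) in the constant and in the
modulus slot. [folklore] -/
private theorem twoLog_updBound_mono {m M : ℕ} {C C' ε X : ℝ} (hε : 0 < ε) (hC : 0 ≤ C)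
    (hCC : C ≤ C') (hmM : m ≤ M) (hX : 0 ≤ X) :
    C * (m : ℝ) ^ (1 + ε) * X ≤ C' * (M : ℝ) ^ (1 + ε) * X :=
  mul_le_mul_of_nonneg_right (mul_le_mul hCC
    (Real.rpow_le_rpow (Nat.cast_nonneg _) (Nat.cast_le.2 hmM) (by linarith))
    (Real.rpow_nonneg (Nat.cast_nonneg _) _) (hC.trans hCC)) hX

/-- Shape (C), the squaring trick: if `a + b = c` and `b < a` in `ℕ`, then `c ∣ a² − b²`
(`Nat.sq_sub_sq`), `b² < a²` and `b² a² ≤ c⁴`. [folklore] -/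
private theorem twoLog_shapeC_sq {a b c : ℕ} (hE : a + b = c) (hlt : b < a) :
    c ∣ a ^ 2 - b ^ 2 ∧ b ^ 2 < a ^ 2 ∧ b ^ 2 * a ^ 2 ≤ c ^ 4 := by
  refine ⟨⟨a - b, by rw [Nat.sq_sub_sq, hE]⟩, Nat.pow_lt_pow_left hlt two_ne_zero, ?_⟩
  calc b ^ 2 * a ^ 2 ≤ c ^ 2 * c ^ 2 :=
      Nat.mul_le_mul (Nat.pow_le_pow_left (by omega) 2) (Nat.pow_le_pow_left (by omega) 2)
    _ = c ^ 4 := by rw [← pow_add]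

/-- Shape (A), the squaring trick: if `1 + n = c` and `2 ≤ n` in `ℕ`, then `c ∣ n² − 1`
(`Nat.sq_sub_sq`), `2 ≤ n²` and `n² ≤ c⁴`. [folklore] -/
private theorem twoLog_shapeA_sq {n c : ℕ} (hE : 1 + n = c) (hn : 2 ≤ n) :
    c ∣ n ^ 2 - 1 ∧ 2 ≤ n ^ 2 ∧ n ^ 2 ≤ c ^ 4 := by
  refine ⟨⟨n - 1, ?_⟩, hn.trans (Nat.le_self_pow two_ne_zero n), ?_⟩
  · rw [← hE, Nat.add_comm 1 n, ← Nat.sq_sub_sq, one_pow]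
  · calc n ^ 2 ≤ c ^ 2 := Nat.pow_le_pow_left (by omega) 2
      _ ≤ c ^ 4 := Nat.pow_le_pow_right (by omega) (by norm_num)

/-- Absorption of a small power: if `c ≥ 1`, `θ < 1` and `c ≤ L · c^θ` in `ℝ`, then
`c ≤ L^{1/(1−θ)}`. [folklore] -/
private theorem twoLog_absorb_rpow {c L θ : ℝ} (hc : 1 ≤ c) (hθ : θ < 1) (h : c ≤ L * c ^ θ) :
    c ≤ L ^ (1 / (1 - θ)) := by
  have hc0 : 0 < c := one_pos.trans_le hc
  have h1θ : 0 < 1 - θ := sub_pos.2 hθ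
  have h1 : c ^ (1 - θ) ≤ L := by
    rw [Real.rpow_sub hc0, Real.rpow_one, div_le_iff₀ (Real.rpow_pos_of_pos hc0 θ)]
    exact h
  calc c = (c ^ (1 - θ)) ^ (1 / (1 - θ)) := by
        rw [← Real.rpow_mul hc0.le, mul_one_div_cancel h1θ.ne', Real.rpow_one]
    _ ≤ L ^ (1 / (1 - θ)) :=
        Real.rpow_le_rpow (Real.rpow_nonneg hc0.le _) h1 (one_div_pos.2 h1θ).le

/-- The common final step of the three shapes: for `ε > 0`, `0 < δ ≤ min(ε, 1)/10`,
`C_U, C₂ > 0`, `M, c ≥ 1` and `0 ≤ X ≤ c⁴` with `c ≤ 2 · (C_U M^(1+δ) X^δ)`: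
`c ≤ L c^{4δ}` with `L = 2 C_U M^(1+δ)`, so `c ≤ L^{1/(1−4δ)} ≤ (2C_U)^{1/(1−4δ)} M^(1+ε)`
(`twoLog_absorb_rpow`; `(1+δ)/(1−4δ) ≤ 1 + ε`), and `c < (C₂ + (2C_U)^{1/(1−4δ)} + 1) M^(1+ε)`.
[folklore] -/
private theorem twoLog_final_lt {ε δ CU C₂ M c X : ℝ} (hε : 0 < ε) (hδ : 0 < δ)
    (hδ1 : δ ≤ 1 / 10) (hδε : δ ≤ ε / 10) (hCU : 0 < CU) (hC₂ : 0 < C₂) (hM : 1 ≤ M)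
    (hc : 1 ≤ c) (h : c ≤ 2 * (CU * M ^ (1 + δ) * X ^ δ)) (hX0 : 0 ≤ X) (hX : X ≤ c ^ 4) :
    c < (C₂ + ((2 * CU) ^ (1 / (1 - 4 * δ)) + 1)) * M ^ (1 + ε) := by
  have hc0 : 0 < c := one_pos.trans_le hc
  have hM0 : 0 < M := one_pos.trans_le hM
  have hθ : 4 * δ < 1 := by linarith
  have hXc : X ^ δ ≤ c ^ (4 * δ) :=
    calc X ^ δ ≤ (c ^ 4) ^ δ := Real.rpow_le_rpow hX0 hX hδ.le
      _ = c ^ (4 * δ) := by rw [← Real.rpow_natCast c 4, ← Real.rpow_mul hc0.le]; norm_num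
  have h1 : c ≤ 2 * CU * M ^ (1 + δ) * c ^ (4 * δ) :=
    calc c ≤ 2 * (CU * M ^ (1 + δ) * X ^ δ) := h
      _ = 2 * CU * M ^ (1 + δ) * X ^ δ := by ring
      _ ≤ 2 * CU * M ^ (1 + δ) * c ^ (4 * δ) := mul_le_mul_of_nonneg_left hXc (by positivity)
  have hexp : (1 + δ) * (1 / (1 - 4 * δ)) ≤ 1 + ε := by
    rw [mul_one_div, div_le_iff₀ (by linarith : (0 : ℝ) < 1 - 4 * δ)]
    have : ε * δ ≤ ε * (1 / 10) := mul_le_mul_of_nonneg_left hδ1 hε.le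
    nlinarith
  have h3 : (2 * CU * M ^ (1 + δ)) ^ (1 / (1 - 4 * δ)) ≤
      (2 * CU) ^ (1 / (1 - 4 * δ)) * M ^ (1 + ε) := by
    rw [Real.mul_rpow (by positivity) (by positivity), ← Real.rpow_mul hM0.le]
    exact mul_le_mul_of_nonneg_left (Real.rpow_le_rpow_of_exponent_le hM hexp) (by positivity)
  calc c ≤ (2 * CU) ^ (1 / (1 - 4 * δ)) * M ^ (1 + ε) := (twoLog_absorb_rpow hc hθ h1).trans h3
    _ < (2 * CU) ^ (1 / (1 - 4 * δ)) * M ^ (1 + ε) + (C₂ + 1) * M ^ (1 + ε) :=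
        lt_add_of_pos_right _ (by positivity)
    _ = (C₂ + ((2 * CU) ^ (1 / (1 - 4 * δ)) + 1)) * M ^ (1 + ε) := by ring

/-! ## The three shapes and the rung `W = 3` from the two-log part UPD⁺(1,2) -/

/-- **The degenerate cell of a shape.** If the abc triple `(a, b, c)` has `abc = p^x q^y r^z` with
`p, q, r` prime and two of the primes coincide or an exponent vanishes, then `ω(abc) ≤ 2`
(`twoLog_card_primeFactors_threePow_le_two`), so the cell bound `H₂` (constant `C₂`) and
`rad(abc) ≤ pqr` give `c < (C₂ + K) (pqr)^(1+ε)` for every `K ≥ 0`. [folklore] -/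
private theorem twoLog_degenerate {ε C₂ K : ℝ} (hε : 0 < ε) (hC₂ : 0 < C₂) (hK : 0 ≤ K)
    (H₂ : ∀ a b c : ℕ, IsABCTriple a b c → (a * b * c).primeFactors.card ≤ 2 →
      (c : ℝ) < C₂ * ((rad a b c : ℕ) : ℝ) ^ (1 + ε))
    {a b c p q r x y z : ℕ} (hp : p.Prime) (hq : q.Prime) (hr : r.Prime) (ht : IsABCTriple a b c)
    (habc : a * b * c = p ^ x * q ^ y * r ^ z)
    (hdeg : p = q ∨ p = r ∨ q = r ∨ x = 0 ∨ y = 0 ∨ z = 0) :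
    (c : ℝ) < (C₂ + K) * ((p * q * r : ℕ) : ℝ) ^ (1 + ε) := by
  have hlt := H₂ a b c ht (habc ▸ twoLog_card_primeFactors_threePow_le_two hp hq hr hdeg)
  have hR : rad a b c ≤ p * q * r := by
    rw [rad_def, habc]; exact twoLog_radical_threePow_le hp hq hr x y z
  exact hlt.trans_le (mul_le_mul (le_add_of_nonneg_right hK)
    (Real.rpow_le_rpow (Nat.cast_nonneg _) (Nat.cast_le.2 hR) (by linarith))
    (Real.rpow_nonneg (Nat.cast_nonneg _) _) (by positivity))

/-- **The three shapes from UPD⁺(1,2), with one constant.** The two-log part of the one-prime /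
two-base bound (hypothesis `hU`: UPD(1,2) for `Y, Z ≥ 1`) implies, for every `ε > 0` with ONE
constant `C = C₂ + (2C_U)^{1/(1−4δ)} + 1` (`δ = min(ε,1)/10`), the bound `c < C · (pqr)^(1+ε)` on
shape (A) `1 + p^x q^y = r^z`, shape (B) `1 + p^x = q^y r^z` and shape (C) `p^x + q^y = r^z`
(`p ≠ q`) with prime bases.  Degenerate case (two primes coincide or an exponent vanishes): the
shape is an abc triple in the cell `ω ≤ 2` (`twoLog_degenerate`, `stub_omegaCounted_two`).  Main
case (`p, q, r` distinct, `x, y, z ≥ 1`), charging ONE prime with both exponents `≥ 1`: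
(A) `r^z ∣ (p^x q^y)² − 1` charges `r` against `p, q` (first alternative, `Y = 2x`, `Z = 2y`,
`t = z`); (B) `p^x ∣ q^y r^z − 1 (= p^x)` charges `p` against `q, r` (first alternative, `Y = y`,
`Z = z`, `t = x`; `q^y r^z ≤ 2 p^x`); (C) `p^x ≠ q^y`, w.l.o.g. `q^y < p^x`, and
`r^z ∣ p^{2x} − q^{2y}` charges `r` against `q, p` (second alternative, `Y = 2y`, `Z = 2x`,
`t = z`); each time `twoLog_final_lt` absorbs `X^δ ≤ c^{4δ}`. [folklore] -/
theorem shapes_of_onePrimeTwoBasePos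
    (hU : ∀ ε : ℝ, 0 < ε → ∃ C : ℝ, 0 < C ∧ ∀ p q r : ℕ, p.Prime → q.Prime → r.Prime →
      p ≠ q → p ≠ r → q ≠ r → ∀ Y Z t : ℕ, 1 ≤ Y → 1 ≤ Z →
      (p ^ t ∣ q ^ Y * r ^ Z - 1 ∧ 2 ≤ q ^ Y * r ^ Z) ∨ (p ^ t ∣ r ^ Z - q ^ Y ∧ q ^ Y < r ^ Z) →
      ((p ^ t : ℕ) : ℝ) ≤ C * ((p * q * r : ℕ) : ℝ) ^ (1 + ε) * ((q ^ Y * r ^ Z : ℕ) : ℝ) ^ ε)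
    (ε : ℝ) (hε : 0 < ε) : ∃ C : ℝ, 0 < C ∧
      (∀ p q r x y z : ℕ, p.Prime → q.Prime → r.Prime → 1 + p ^ x * q ^ y = r ^ z →
        ((r ^ z : ℕ) : ℝ) < C * ((p * q * r : ℕ) : ℝ) ^ (1 + ε)) ∧
      (∀ p q r x y z : ℕ, p.Prime → q.Prime → r.Prime → 1 + p ^ x = q ^ y * r ^ z →
        ((q ^ y * r ^ z : ℕ) : ℝ) < C * ((p * q * r : ℕ) : ℝ) ^ (1 + ε)) ∧
      (∀ p q r x y z : ℕ, p.Prime → q.Prime → r.Prime → p ≠ q → p ^ x + q ^ y = r ^ z →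
        ((r ^ z : ℕ) : ℝ) < C * ((p * q * r : ℕ) : ℝ) ^ (1 + ε)) := by
  obtain ⟨δ, hδ0, hδ1, hδε⟩ : ∃ δ : ℝ, 0 < δ ∧ δ ≤ 1 / 10 ∧ δ ≤ ε / 10 :=
    ⟨min ε 1 / 10, by positivity, by linarith [min_le_right ε 1], by linarith [min_le_left ε 1]⟩
  obtain ⟨C₂, hC₂, H₂⟩ := stub_omegaCounted_two ε hε
  obtain ⟨CU, hCU, HU⟩ := hU δ hδ0
  have hM1 : ∀ {p q r : ℕ}, p.Prime → q.Prime → r.Prime → (1 : ℝ) ≤ ((p * q * r : ℕ) : ℝ) :=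
    fun hp hq hr => by exact_mod_cast Nat.mul_pos (Nat.mul_pos hp.pos hq.pos) hr.pos
  refine ⟨C₂ + ((2 * CU) ^ (1 / (1 - 4 * δ)) + 1), by positivity, fun p q r x y z hp hq hr hE => ?_,
    fun p q r x y z hp hq hr hE => ?_, fun p q r x y z hp hq hr hpq hE => ?_⟩
  · -- shape (A) `1 + p^x q^y = r^z`
    by_cases hdeg : p = q ∨ p = r ∨ q = r ∨ x = 0 ∨ y = 0 ∨ z = 0
    · exact twoLog_degenerate hε hC₂ (by positivity) H₂ hp hq hr
        ⟨one_pos, mul_pos (pow_pos hp.pos x) (pow_pos hq.pos y), hE, Nat.coprime_one_left _⟩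
        (by ring) hdeg
    -- main case: charge `r` against the bases `p, q` (`r^z ∣ p^(2x) q^(2y) - 1`, `2x, 2y ≥ 1`)
    simp only [not_or] at hdeg
    obtain ⟨hpq, hpr, hqr, hx, hy, -⟩ := hdeg
    have hc1 : (1 : ℝ) ≤ ((r ^ z : ℕ) : ℝ) := by exact_mod_cast Nat.one_le_pow z r hr.pos
    have hn2 : 2 ≤ p ^ x * q ^ y := (hp.two_le.trans (Nat.le_self_pow hx p)).trans
      (Nat.le_mul_of_pos_right _ (pow_pos hq.pos y))
    have hsq : p ^ (2 * x) * q ^ (2 * y) = (p ^ x * q ^ y) ^ 2 := by ring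
    obtain ⟨hdvd, h2, hX⟩ := twoLog_shapeA_sq hE hn2
    have key := HU r p q hr hp hq (Ne.symm hpr) (Ne.symm hqr) hpq (2 * x) (2 * y) z (by omega)
      (by omega) (Or.inl (by rw [hsq]; exact ⟨hdvd, h2⟩))
    rw [show r * p * q = p * q * r by ring, hsq] at key
    exact twoLog_final_lt hε hδ0 hδ1 hδε hCU hC₂ (hM1 hp hq hr) hc1
      (key.trans (le_mul_of_one_le_left (by positivity) one_le_two)) (Nat.cast_nonneg _)
      (by exact_mod_cast hX)
  · -- shape (B) `1 + p^x = q^y r^z`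
    by_cases hdeg : p = q ∨ p = r ∨ q = r ∨ x = 0 ∨ y = 0 ∨ z = 0
    · exact twoLog_degenerate hε hC₂ (by positivity) H₂ hp hq hr
        ⟨one_pos, pow_pos hp.pos x, hE, Nat.coprime_one_left _⟩ (by ring) hdeg
    -- main case: charge `p` against the bases `q, r` (`p^x ∣ q^y r^z - 1`, `y, z ≥ 1`)
    simp only [not_or] at hdeg
    obtain ⟨hpq, hpr, hqr, -, hy, hz⟩ := hdeg
    have hpx : 1 ≤ p ^ x := Nat.one_le_pow x p hp.pos
    have hc1 : (1 : ℝ) ≤ ((q ^ y * r ^ z : ℕ) : ℝ) := by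
      exact_mod_cast (by omega : 1 ≤ q ^ y * r ^ z)
    have h2c : ((q ^ y * r ^ z : ℕ) : ℝ) ≤ 2 * ((p ^ x : ℕ) : ℝ) := by
      exact_mod_cast (by omega : q ^ y * r ^ z ≤ 2 * p ^ x)
    have hX : ((q ^ y * r ^ z : ℕ) : ℝ) ≤ ((q ^ y * r ^ z : ℕ) : ℝ) ^ 4 := by
      exact_mod_cast Nat.le_self_pow (by norm_num) (q ^ y * r ^ z)
    have key := HU p q r hp hq hr hpq hpr hqr y z x (Nat.one_le_iff_ne_zero.2 hy)
      (Nat.one_le_iff_ne_zero.2 hz) (Or.inl ⟨⟨1, by omega⟩, by omega⟩)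
    exact twoLog_final_lt hε hδ0 hδ1 hδε hCU hC₂ (hM1 hp hq hr) hc1
      (h2c.trans (mul_le_mul_of_nonneg_left key zero_le_two)) (Nat.cast_nonneg _) hX
  · -- shape (C) `p^x + q^y = r^z`, `p ≠ q`
    by_cases hdeg : p = q ∨ p = r ∨ q = r ∨ x = 0 ∨ y = 0 ∨ z = 0
    · exact twoLog_degenerate hε hC₂ (by positivity) H₂ hp hq hr ⟨pow_pos hp.pos x,
        pow_pos hq.pos y, hE, Nat.Coprime.pow x y ((Nat.coprime_primes hp hq).2 hpq)⟩ rfl hdeg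
    -- main case: w.l.o.g. `q^y < p^x`; charge `r` against `q, p` (`r^z ∣ p^(2x) - q^(2y)`)
    simp only [not_or] at hdeg
    obtain ⟨-, hpr, hqr, hx, hy, -⟩ := hdeg
    have hne : p ^ x ≠ q ^ y := fun h =>
      hpq (Nat.prime_eq_prime_of_dvd_pow hp hq (by rw [← h]; exact dvd_pow_self p hx))
    wlog hlt : q ^ y < p ^ x generalizing p q x y
    · rw [show p * q * r = q * p * r by ring]
      exact this q p y x hq hp (Ne.symm hpq) ((Nat.add_comm _ _).trans hE) hqr hpr hy hx hne.symm
        (lt_of_le_of_ne (not_lt.1 hlt) hne)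
    have hc1 : (1 : ℝ) ≤ ((r ^ z : ℕ) : ℝ) := by exact_mod_cast Nat.one_le_pow z r hr.pos
    have h2x : p ^ (2 * x) = (p ^ x) ^ 2 := pow_mul' p 2 x
    have h2y : q ^ (2 * y) = (q ^ y) ^ 2 := pow_mul' q 2 y
    obtain ⟨hdvd, hlt2, hX⟩ := twoLog_shapeC_sq hE hlt
    have key := HU r q p hr hq hp (Ne.symm hqr) (Ne.symm hpr) (Ne.symm hpq) (2 * y) (2 * x) z
      (by omega) (by omega) (Or.inr (by rw [h2x, h2y]; exact ⟨hdvd, hlt2⟩))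
    rw [show r * q * p = p * q * r by ring, h2x, h2y] at key
    exact twoLog_final_lt hε hδ0 hδ1 hδε hCU hC₂ (hM1 hp hq hr) hc1
      (key.trans (le_mul_of_one_le_left (by positivity) one_le_two)) (Nat.cast_nonneg _)
      (by exact_mod_cast hX)

/-- **boundedOmegaAt_three_of_onePrimeTwoBasePos (`B₃` from the two-log part UPD⁺(1,2)).** The
two-log part of the one-prime / two-base divisibility bound (hypothesis `hU`: for distinct primes
`p, q, r` and `Y, Z ≥ 1`, `p^t ∣ q^Y r^Z − 1` or `p^t ∣ r^Z − q^Y` forces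
`p^t ≤ C(ε) (pqr)^(1+ε) (q^Y r^Z)^ε`) already implies the first open rung `W = 3` of
BoundedOmegaABC: abc with `C = C(ε)` on the cell `ω(abc) ≤ 3`.  By `boundedOmegaAt_three_iff_shapes`
it suffices to bound the three shapes (`shapes_of_onePrimeTwoBasePos`); the one-log axis
(`Y = 0` or `Z = 0`) of UPD(1,2) is never used at rung `3`. [folklore] -/
theorem boundedOmegaAt_three_of_onePrimeTwoBasePos
    (hU : ∀ ε : ℝ, 0 < ε → ∃ C : ℝ, 0 < C ∧ ∀ p q r : ℕ, p.Prime → q.Prime → r.Prime →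
      p ≠ q → p ≠ r → q ≠ r → ∀ Y Z t : ℕ, 1 ≤ Y → 1 ≤ Z →
      (p ^ t ∣ q ^ Y * r ^ Z - 1 ∧ 2 ≤ q ^ Y * r ^ Z) ∨ (p ^ t ∣ r ^ Z - q ^ Y ∧ q ^ Y < r ^ Z) →
      ((p ^ t : ℕ) : ℝ) ≤ C * ((p * q * r : ℕ) : ℝ) ^ (1 + ε) * ((q ^ Y * r ^ Z : ℕ) : ℝ) ^ ε) :
    ∀ ε : ℝ, 0 < ε → ∃ C : ℝ, 0 < C ∧ ∀ a b c : ℕ, IsABCTriple a b c →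
      (a * b * c).primeFactors.card ≤ 3 → (c : ℝ) < C * ((rad a b c : ℕ) : ℝ) ^ (1 + ε) :=
  boundedOmegaAt_three_iff_shapes.mpr
    ⟨fun ε hε => (shapes_of_onePrimeTwoBasePos hU ε hε).imp fun _ h => ⟨h.1, h.2.1⟩,
      fun ε hε => (shapes_of_onePrimeTwoBasePos hU ε hε).imp fun _ h => ⟨h.1, h.2.2.1⟩,
      fun ε hε => (shapes_of_onePrimeTwoBasePos hU ε hε).imp fun _ h => ⟨h.1, h.2.2.2⟩⟩

/-! ## Axis separation: UPD(1,2) ⟺ UPD⁺(1,2) ∧ UPD(1,1) -/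

/-- For any `p, r` there is a prime `q ≤ 5` distinct from both: one of `2, 3, 5`. [folklore] -/
private theorem twoLog_exists_aux_prime (p r : ℕ) : ∃ q : ℕ, q.Prime ∧ p ≠ q ∧ q ≠ r ∧ q ≤ 5 := by
  by_cases h2 : p = 2 ∨ r = 2
  · by_cases h3 : p = 3 ∨ r = 3
    · exact ⟨5, Nat.prime_five, by omega, by omega, le_rfl⟩
    · exact ⟨3, Nat.prime_three, by omega, by omega, by norm_num⟩
  · exact ⟨2, Nat.prime_two, by omega, by omega, by norm_num⟩

/-- **onePrimeTwoBase_iff_pos_and_oneBase (axis separation of UPD(1,2)).** The one-prime /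
two-base divisibility bound UPD(1,2) is equivalent to the conjunction of its two-log part
UPD⁺(1,2) (the same statement for `Y, Z ≥ 1`) and its one-log / one-base axis UPD(1,1)
(`p^t ∣ r^Z − 1`, `r^Z ≥ 2` `⟹ p^t ≤ C (pr)^(1+ε) (r^Z)^ε` for primes `p ≠ r`).  (→) UPD⁺ by
dropping the binders `1 ≤ Y`, `1 ≤ Z`; UPD(1,1) from UPD with `Y = 0` and an auxiliary prime
`q ∈ {2, 3, 5}` distinct from `p, r` (`twoLog_exists_aux_prime`), with the constant `C · 5^(1+ε)`
since `(pqr)^(1+ε) ≤ (5pr)^(1+ε)`.  (←) with the constant `C⁺ + C₁`: for `Y = 0` both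
alternatives read `p^t ∣ r^Z − 1`, `r^Z ≥ 2` (UPD(1,1) for `(p, r)`, `(pr)^(1+ε) ≤ (pqr)^(1+ε)`);
for `Z = 0` the first alternative is `p^t ∣ q^Y − 1`, `q^Y ≥ 2` (UPD(1,1) for `(p, q)`) and the
second (`q^Y < 1`) is void; for `Y, Z ≥ 1` it is UPD⁺. [folklore] -/
theorem onePrimeTwoBase_iff_pos_and_oneBase :
    (∀ ε : ℝ, 0 < ε → ∃ C : ℝ, 0 < C ∧ ∀ p q r : ℕ, p.Prime → q.Prime → r.Prime →
      p ≠ q → p ≠ r → q ≠ r → ∀ Y Z t : ℕ,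
      (p ^ t ∣ q ^ Y * r ^ Z - 1 ∧ 2 ≤ q ^ Y * r ^ Z) ∨ (p ^ t ∣ r ^ Z - q ^ Y ∧ q ^ Y < r ^ Z) →
      ((p ^ t : ℕ) : ℝ) ≤ C * ((p * q * r : ℕ) : ℝ) ^ (1 + ε) * ((q ^ Y * r ^ Z : ℕ) : ℝ) ^ ε) ↔
    ((∀ ε : ℝ, 0 < ε → ∃ C : ℝ, 0 < C ∧ ∀ p q r : ℕ, p.Prime → q.Prime → r.Prime →
        p ≠ q → p ≠ r → q ≠ r → ∀ Y Z t : ℕ, 1 ≤ Y → 1 ≤ Z →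
        (p ^ t ∣ q ^ Y * r ^ Z - 1 ∧ 2 ≤ q ^ Y * r ^ Z) ∨ (p ^ t ∣ r ^ Z - q ^ Y ∧ q ^ Y < r ^ Z) →
        ((p ^ t : ℕ) : ℝ) ≤ C * ((p * q * r : ℕ) : ℝ) ^ (1 + ε) * ((q ^ Y * r ^ Z : ℕ) : ℝ) ^ ε) ∧
      (∀ ε : ℝ, 0 < ε → ∃ C : ℝ, 0 < C ∧ ∀ p r : ℕ, p.Prime → r.Prime → p ≠ r → ∀ Z t : ℕ,
        p ^ t ∣ r ^ Z - 1 → 2 ≤ r ^ Z →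
        ((p ^ t : ℕ) : ℝ) ≤ C * ((p * r : ℕ) : ℝ) ^ (1 + ε) * ((r ^ Z : ℕ) : ℝ) ^ ε)) := by
  constructor
  · intro hU
    refine ⟨fun ε hε => ?_, fun ε hε => ?_⟩
    · -- the two-log part: drop the two extra binders
      obtain ⟨C, hC, H⟩ := hU ε hε
      exact ⟨C, hC, fun p q r hp hq hr hpq hpr hqr Y Z t _ _ h =>
        H p q r hp hq hr hpq hpr hqr Y Z t h⟩
    · -- the one-log axis: `Y = 0` with an auxiliary prime `q ∈ {2, 3, 5}`
      obtain ⟨C, hC, H⟩ := hU ε hε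
      refine ⟨C * 5 ^ (1 + ε), by positivity, fun p r hp hr hpr Z t hdvd h2 => ?_⟩
      obtain ⟨q, hq, hpq, hqr, hq5⟩ := twoLog_exists_aux_prime p r
      have key := H p q r hp hq hr hpq hpr hqr 0 Z t
        (Or.inl ⟨by rwa [pow_zero, one_mul], by rwa [pow_zero, one_mul]⟩)
      simp only [pow_zero, one_mul] at key
      -- `(pqr)^(1+ε) ≤ (5 · pr)^(1+ε) = 5^(1+ε) · (pr)^(1+ε)`
      have hle : p * q * r ≤ 5 * (p * r) :=
        calc p * q * r = q * (p * r) := by ring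
          _ ≤ 5 * (p * r) := Nat.mul_le_mul_right _ hq5
      have hcast : ((5 * (p * r) : ℕ) : ℝ) = 5 * ((p * r : ℕ) : ℝ) := by push_cast; ring
      have h5 : ((p * q * r : ℕ) : ℝ) ^ (1 + ε) ≤ 5 ^ (1 + ε) * ((p * r : ℕ) : ℝ) ^ (1 + ε) :=
        calc ((p * q * r : ℕ) : ℝ) ^ (1 + ε) ≤ ((5 * (p * r) : ℕ) : ℝ) ^ (1 + ε) :=
              Real.rpow_le_rpow (Nat.cast_nonneg _) (Nat.cast_le.2 hle) (by linarith)
          _ = 5 ^ (1 + ε) * ((p * r : ℕ) : ℝ) ^ (1 + ε) := by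
              rw [hcast, Real.mul_rpow (by norm_num) (Nat.cast_nonneg _)]
      calc ((p ^ t : ℕ) : ℝ) ≤ C * ((p * q * r : ℕ) : ℝ) ^ (1 + ε) * ((r ^ Z : ℕ) : ℝ) ^ ε := key
        _ ≤ C * (5 ^ (1 + ε) * ((p * r : ℕ) : ℝ) ^ (1 + ε)) * ((r ^ Z : ℕ) : ℝ) ^ ε :=
            mul_le_mul_of_nonneg_right (mul_le_mul_of_nonneg_left h5 hC.le)
              (Real.rpow_nonneg (Nat.cast_nonneg _) _)
        _ = C * 5 ^ (1 + ε) * ((p * r : ℕ) : ℝ) ^ (1 + ε) * ((r ^ Z : ℕ) : ℝ) ^ ε := by ring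
  · rintro ⟨hP, h1⟩ ε hε
    obtain ⟨CP, hCP, HP⟩ := hP ε hε
    obtain ⟨C1, hC1, H1⟩ := h1 ε hε
    refine ⟨CP + C1, by positivity, fun p q r hp hq hr hpq hpr hqr Y Z t h => ?_⟩
    rcases Nat.eq_zero_or_pos Y with rfl | hY
    · -- `Y = 0`: both alternatives read `p^t ∣ r^Z - 1` with `2 ≤ r^Z`
      simp only [pow_zero, one_mul] at h ⊢
      have h' : p ^ t ∣ r ^ Z - 1 ∧ 2 ≤ r ^ Z := h.elim id fun h => ⟨h.1, by omega⟩
      have hm : p * r ≤ p * q * r :=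
        le_of_le_of_eq (Nat.le_mul_of_pos_right _ hq.pos) (Nat.mul_right_comm p r q)
      exact (H1 p r hp hr hpr Z t h'.1 h'.2).trans (twoLog_updBound_mono hε hC1.le
        (le_add_of_nonneg_left hCP.le) hm (Real.rpow_nonneg (Nat.cast_nonneg _) _))
    rcases Nat.eq_zero_or_pos Z with rfl | hZ
    · -- `Z = 0`: the first alternative is `p^t ∣ q^Y - 1` with `2 ≤ q^Y`, the second is void
      simp only [pow_zero, mul_one] at h ⊢
      rcases h with h | h
      · exact (H1 p q hp hq hpq Y t h.1 h.2).trans (twoLog_updBound_mono hε hC1.le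
          (le_add_of_nonneg_left hCP.le) (Nat.le_mul_of_pos_right _ hr.pos)
          (Real.rpow_nonneg (Nat.cast_nonneg _) _))
      · exact absurd h.2 (not_lt.2 (Nat.one_le_pow Y q hq.pos))
    · -- `Y, Z ≥ 1`: the two-log part
      exact (HP p q r hp hq hr hpq hpr hqr Y Z t hY hZ h).trans (twoLog_updBound_mono hε hCP.le
        (le_add_of_nonneg_right hC1.le) le_rfl (Real.rpow_nonneg (Nat.cast_nonneg _) _))

end Summit.ABC.ABC.Theorems.UniformSadicTowerFour.BoundedOmega

end
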